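import Summits.BirchSwinnertonDyer.BirchSwinnertonDyer.Theorems.ErratumRoadFiveSigmaLocalMultCharpoly
import Summits.BirchSwinnertonDyer.BirchSwinnertonDyer.Theorems.ErratumRoadFiveSigmaLocalAllPlaces
import Summits.BirchSwinnertonDyer.BirchSwinnertonDyer.Theses.ErratumRoadFive
import Literature.NumberTheory.GaloisRepresentations.TameInertiaGeneratorEvaluationProofs
import HarnessLib

/-!
# K2 support item 20495 `JSWSigmaLocalCharIdeal` PROVED: the local `Σ`-atom
# `JetchevSkinnerWan2017.sigmaLocal_charIdeal_eulerFactor_mem_of_noTamagawaDefect` holds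

Cell `bsd-stepL`, K2 route `ErratumRoadFive`, support item stmt-BirchSwinnertonDyer-20495
`JSWSigmaLocalCharIdeal` (route decl `Summit.BirchSwinnertonDyer.BirchSwinnertonDyer.Theses.ErratumRoadFive.JSWSigmaLocalCharIdeal`
`:= Literature.NumberTheory.EllipticCurves.JetchevSkinnerWan2017.sigmaLocal_charIdeal_eulerFactor_mem_of_noTamagawaDefect`);
seat `bsd-stepL-imc-p1` (g14), closing the L1–L6 plan of the lineage (g12–g14) and the typer lane
`bsd-stepL-defn-ty1` (g9–g11). THEOREMS ONLY (no definition, no named fact, no `sorry`).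

The atom (for `E/ℚ`, `p ≥ 3`, `K` imaginary quadratic, `κ` anticyclotomic, `w ∤ p` with Euler datum
`(Nw, t, c)` and `NoTamagawaDefect p t c`: `X_w = H¹(K_w, T_pE ⊗ Λ^*(Ψ⁻¹))^∨` is finitely generated and
torsion over `Λ` and `eulerFactor p ℤ_[p] Nw t c ∈ Ch_Λ(X_w)`) was reduced by
`SigmaLocal.sigmaLocal_of_eulerFactor_mem_span_intrinsic` (p574664) to (S5): at every finitely decomposed place
of good ∕ multiplicative reduction, `eulerFactor p ℤ_[p] Nw t c` lies in the principal ideal of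
`(charpoly Lt).reverse((1+T)^{−c})`, `Lt` the dual Frobenius on `H¹(I_w, E[p^∞])^∨ ⧸ tors`. Here (S5) is
assembled by reduction type:

* good `w`: `SigmaLocal.eulerFactor_good_mem_span_of_exists_eval` (p580440: `charpoly Lt = X² − (a_w/q_w)X + 1/q_w`)
  with the evaluation isomorphism `H¹(I_w, E[p^∞]) ≃ E[p^∞]` of the typer lane
  (`exists_continuousCohomology_absInertia_equiv_eval`, p580000; `E[p^∞]` is unramified at `w`);
* split ∕ non-split multiplicative `w`: `SigmaLocal.eulerFactor_[non]splitMult_mem_span`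
  (`ErratumRoadFiveSigmaLocalMultCharpoly`: `charpoly Lt = X ∓ 1/q_w` via the coinvariant evaluation
  isomorphism `H¹(I_w, E[p^∞]) ≃ E[p^∞]_{I_w}`, p581450 ∕ p581979 ∕ p582402, the unipotence of inertia and
  `Frob = ±1` on the coinvariant line of `V_pE`).

* `SigmaLocal.eulerFactor_mem_span_intrinsic` — (S5), literally the hypothesis `hS5` of p574664;
* `jswSigmaLocalCharIdeal_holds : Theses.ErratumRoadFive.JSWSigmaLocalCharIdeal` — **the item, by name**;
* `sigmaLocal_charIdeal_eulerFactor_mem_of_noTamagawaDefect_proved` — the same statement under its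
  Literature name (the route decl unfolds to it by `rfl`).

HONEST FRAMING: a K2 SUPPORT item (a published local statement, [JetchevSkinnerWan2017] proof of Thm. 6.1.6
∕ [Skinner2016PacificMC] §2.3 ∕ [GreenbergVatsal2000] Prop. 2.4) becomes a theorem of the tree; nothing
about BSD is proved by this; closes: none of the rung's cruxes (T7).

References: [GreenbergVatsal2000] §2 Prop. 2.4 and proof (arXiv pp. 21–23); [Skinner2016PacificMC] §2.3 (p. 180);
[JetchevSkinnerWan2017] §3.3, proof of Thm. 6.1.6; [SerreInventiones1972] §1.3, §1.8; [SilvermanATAEC1994]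
Thm. IV.10.2, V.5.3, Ex. 5.13; [SilvermanAEC2009] VII.4.1, C.21.
-/

noncomputable section

open scoped Classical
open Polynomial Field NumberField IsDedekindDomain WeierstrassCurve
open Literature.NumberTheory.EllipticCurves Literature.NumberTheory.GaloisRepresentations
  Literature.NumberTheory.EllipticCurves.BigGaloisRep
  Literature.NumberTheory.GaloisRepresentations.IsNonarchimedeanLocalField
  Literature.NumberTheory.EllipticCurves.JetchevSkinnerWan2017 Literature.NumberTheory.EllipticCurves.IwasawaCharacter

set_option autoImplicit false
-- the Theorems namespace of this sub repeats the summit name by design (D-0017 nested layout)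
set_option linter.dupNamespace false

namespace Summit.BirchSwinnertonDyer.BirchSwinnertonDyer.Theorems

open _root_.TopRep _root_.ContinuousCohomology

/-- **(S5): the Euler-factor identification at every finitely decomposed place of good or multiplicative
reduction** — literally the hypothesis `hS5` of `SigmaLocal.sigmaLocal_of_eulerFactor_mem_span_intrinsic`:
`eulerFactor p ℤ_[p] Nw t c ∈ ((charpoly Lt).reverse((1+T)^{−c}))` for the dual Frobenius `Lt` on
`H¹(I_w, E[p^∞])^∨ ⧸ tors`. By reduction type: good (`X² − (a_w/q_w)X + 1/q_w`), split (`X − 1/q_w`),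
non-split (`X + 1/q_w`). [cite: GreenbergVatsal2000, Prop. 2.4 and proof (arXiv p. 22)]
[cite: Skinner2016PacificMC, §2.3 (p. 180)] -/
theorem SigmaLocal.eulerFactor_mem_span_intrinsic
    (W : WeierstrassCurve ℚ) [W.IsElliptic] (p : ℕ) [Fact p.Prime] (_hp : 3 ≤ p)
    (K : Type) [Field K] [NumberField K] (_hK : IsImaginaryQuadratic K)
    (κ : ZpExtension K p) (_hκ : κ.IsAnticyclotomic)
    (w : HeightOneSpectrum (𝓞 K)) (hw : ((p : ℕ) : 𝓞 K) ∉ w.asIdeal)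
    (Nw : ℕ) (t : LocalReductionData) (c : ℤ_[p])
    (hdata : IsEulerDataAt (W.baseChange K) κ w Nw t c) (_hc : c ≠ 0) (ht : t ≠ .additive)
    (φ : absoluteGaloisGroup (w.adicCompletion K)) (hφ : IsFrobPow φ 1)
    (_hκφ : κ (localMap K (Sum.inl w) φ) = Multiplicative.ofAdd c)
    [ContinuousSMul ℤ_[p] (PrimaryTorsion (geomPoints (W.baseChange K)) p)]
    [Module.Finite ℤ_[p] (CharacterModule (continuousCohomology 1 (subgroupRep
      ((((W.baseChange K).primaryTorsionGaloisRep p).restrict (localMap K (Sum.inl w)) :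
        ContinuousRep (absoluteGaloisGroup (w.adicCompletion K)) ℤ_[p]
          (PrimaryTorsion (geomPoints (W.baseChange K)) p))).toTopRep (absInertia (w.adicCompletion K)))))]
    (Lt : (CharacterModule (continuousCohomology 1 (subgroupRep
        ((((W.baseChange K).primaryTorsionGaloisRep p).restrict (localMap K (Sum.inl w)) :
          ContinuousRep (absoluteGaloisGroup (w.adicCompletion K)) ℤ_[p]
            (PrimaryTorsion (geomPoints (W.baseChange K)) p))).toTopRep (absInertia (w.adicCompletion K)))) ⧸
        Submodule.torsion ℤ_[p] (CharacterModule (continuousCohomology 1 (subgroupRep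
          ((((W.baseChange K).primaryTorsionGaloisRep p).restrict (localMap K (Sum.inl w)) :
            ContinuousRep (absoluteGaloisGroup (w.adicCompletion K)) ℤ_[p]
              (PrimaryTorsion (geomPoints (W.baseChange K)) p))).toTopRep
            (absInertia (w.adicCompletion K)))))) →ₗ[ℤ_[p]]
      (CharacterModule (continuousCohomology 1 (subgroupRep
        ((((W.baseChange K).primaryTorsionGaloisRep p).restrict (localMap K (Sum.inl w)) :
          ContinuousRep (absoluteGaloisGroup (w.adicCompletion K)) ℤ_[p]
            (PrimaryTorsion (geomPoints (W.baseChange K)) p))).toTopRep (absInertia (w.adicCompletion K)))) ⧸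
        Submodule.torsion ℤ_[p] (CharacterModule (continuousCohomology 1 (subgroupRep
          ((((W.baseChange K).primaryTorsionGaloisRep p).restrict (localMap K (Sum.inl w)) :
            ContinuousRep (absoluteGaloisGroup (w.adicCompletion K)) ℤ_[p]
              (PrimaryTorsion (geomPoints (W.baseChange K)) p))).toTopRep
            (absInertia (w.adicCompletion K)))))))
    (hLt : ∀ χ, Lt (Submodule.Quotient.mk χ) = Submodule.Quotient.mk
      (CharacterModule.dual (conjMap ((((W.baseChange K).primaryTorsionGaloisRep p).restrict
          (localMap K (Sum.inl w)) :
        ContinuousRep (absoluteGaloisGroup (w.adicCompletion K)) ℤ_[p]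
          (PrimaryTorsion (geomPoints (W.baseChange K)) p))).toTopRep
        (absInertia (w.adicCompletion K)) φ 1).hom.toLinearMap χ)) :
    eulerFactor p ℤ_[p] Nw t c ∈
      Ideal.span {Polynomial.aeval (BigRepModule.binomSeries ℤ_[p] (-c)) (LinearMap.charpoly Lt).reverse} := by
  haveI : (W.baseChange K).IsElliptic := by rw [WeierstrassCurve.baseChange]; infer_instance
  haveI : (absInertia (w.adicCompletion K)).Normal := absInertia_normal_holds (w.adicCompletion K)
  cases t with
  | good a =>
    obtain ⟨τ, e, he⟩ := exists_continuousCohomology_absInertia_equiv_eval (w.adicCompletion K)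
      ((((W.baseChange K).primaryTorsionGaloisRep p).restrict (localMap K (Sum.inl w)) :
        ContinuousRep (absoluteGaloisGroup (w.adicCompletion K)) ℤ_[p]
          (PrimaryTorsion (geomPoints (W.baseChange K)) p)))
      (w.ringChar_residueField_adicCompletion_ne hw)
      (SigmaLocal.primaryTorsion_exists_pow_nsmul_eq_zero (W.baseChange K) p)
      (fun σ hσ b => SigmaLocal.primaryTorsionGaloisRep_localMap_eq_of_mem_absInertia (W.baseChange K) p
        hdata.2.2.1 hw hσ b)
    exact SigmaLocal.eulerFactor_good_mem_span_of_exists_eval (W.baseChange K) p hw κ hdata hφ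
      ⟨τ, e, he⟩ Lt hLt
  | splitMult => exact SigmaLocal.eulerFactor_splitMult_mem_span (W.baseChange K) p hw κ hdata hφ Lt hLt
  | nonsplitMult =>
    exact SigmaLocal.eulerFactor_nonsplitMult_mem_span (W.baseChange K) p hw κ hdata hφ Lt hLt
  | additive => exact absurd rfl ht

/-- **K2 support item 20495 `JSWSigmaLocalCharIdeal`, by name.** The route declaration
`Theses.ErratumRoadFive.JSWSigmaLocalCharIdeal` (= the Literature fact
`JetchevSkinnerWan2017.sigmaLocal_charIdeal_eulerFactor_mem_of_noTamagawaDefect`: the local `Σ`-atom —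
for `E/ℚ`, `p ≥ 3`, `K` imaginary quadratic, `κ` anticyclotomic, `w ∤ p` with Euler datum `(Nw, t, c)` and no
Tamagawa defect, `X_w = H¹(K_w, T_pE ⊗ Λ^*(Ψ⁻¹))^∨` is finitely generated torsion over `Λ` with
`eulerFactor p ℤ_[p] Nw t c ∈ Ch_Λ(X_w)`) HOLDS: `SigmaLocal.sigmaLocal_of_eulerFactor_mem_span_intrinsic`
applied to (S5) `SigmaLocal.eulerFactor_mem_span_intrinsic`.
[cite: JetchevSkinnerWan2017, proof of Thm. 6.1.6 (local display)] [cite: Skinner2016PacificMC, §2.3 (p. 180)]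
[cite: GreenbergVatsal2000, Prop. 2.4] -/
theorem jswSigmaLocalCharIdeal_holds :
    Summit.BirchSwinnertonDyer.BirchSwinnertonDyer.Theses.ErratumRoadFive.JSWSigmaLocalCharIdeal :=
  SigmaLocal.sigmaLocal_of_eulerFactor_mem_span_intrinsic
    fun W _ p _ hp K _ _ hK κ hκ w hw Nw t c hdata hc ht φ hφ hκφ _ _ Lt hLt =>
      SigmaLocal.eulerFactor_mem_span_intrinsic W p hp K hK κ hκ w hw Nw t c hdata hc ht φ hφ hκφ Lt hLt

/-- The same statement under its Literature name: **[JetchevSkinnerWan2017] proof of Thm. 6.1.6 (local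
display) = [Skinner2016PacificMC] §2.3 = [GreenbergVatsal2000] Prop. 2.4, away from the Tamagawa defect,
is a theorem of the tree.** [cite: GreenbergVatsal2000, Prop. 2.4] [cite: Skinner2016PacificMC, §2.3 (p. 180)] -/
theorem sigmaLocal_charIdeal_eulerFactor_mem_of_noTamagawaDefect_proved :
    Literature.NumberTheory.EllipticCurves.JetchevSkinnerWan2017.sigmaLocal_charIdeal_eulerFactor_mem_of_noTamagawaDefect :=
  jswSigmaLocalCharIdeal_holds

end Summit.BirchSwinnertonDyer.BirchSwinnertonDyer.Theorems

end
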